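import Summits.HodgeConjecture.HodgeConjecture.Theorems.K2LiuAdelicHeightBoxVolume
import Summits.HodgeConjecture.HodgeConjecture.Theorems.K2LiuArchHeightBallVolume
import Summits.HodgeConjecture.HodgeConjecture.Theorems.K2LiuFiniteHeightCosetSeparation
import Summits.HodgeConjecture.HodgeConjecture.Theorems.K2LiuFiniteHeightCosetCount
import Literature.NumberTheory.Automorphic.UnitaryGroupOfFormAdelicTopology
import Literature.NumberTheory.GelbartRogawski1991.DoubledUnitaryGlobalSplittingData
import HarnessLib

/-!
# Weil's adelic integrability criterion for `U(V)(𝔸)` — socket #16b `sig_K2LiuAdelicNormIntegrable`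

Track B ∕ hLiu418 = stmt-HodgeConjecture-24832, line `K2_Liu_CurveThetaSigs`, unit U5 «DOUBLING ZETA», organ (IV-d); socket #16b
`sig_K2LiuAdelicNormIntegrable` of `Cruxes/HLiu418/Lines/K2_Liu_CurveThetaSigs_U5_DoublingZeta.lean` (ED. 5∕6, :266∕:273) PAID BY NAME
by `adelicNormIntegrable` below (statement byte-identical). Seat `hodgecm-mathlib-K2Liu-p03` (g2), steward of the #16b crew
(plan `K2/K2Liu-p03/g2/PLAN-16b-AdelicNormIntegrable.v2.K2Liu-p03-g2.md`); FILE 6 of 6, the assembly: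

* ★ FILE 1 `K2LiuSmearingVolumeBound` (p03) — smearing inequality, layer cake;
* ★ FILE 2 `K2LiuArchHeightBallVolume` (K2Liu-p07) — `μ_∞{H_∞ ≤ T} ≤ C T^{D_∞}` for every Haar measure on `GL_N(L ⊗ ℝ)`;
* ★ FILE 3 `K2LiuFiniteHeightCosetSeparation` (K2Liu-p06) — `H_v(y) = H_v((1, y_f))`, exact values, coset separation;
* ★ FILE 4 `K2LiuFiniteHeightCosetCount` (K2Liu-p02) — the finite height ball `{∏_v H_v ≤ T}` of `GL_N(𝔸_{L,f})` is covered by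
  `≤ C T^{D_f}` cosets of `GL_N(𝒪̂)`;
* ★ FILE 5 `K2LiuClosedSubgroupHeightBallVolume` (p03) — for a closed `G ≤ GL_N(𝔸_L)`: `ν{‖g‖ ≤ T} ≤ C μ{H_∞ ≤ B₁T ∧ ∏ H_v ≤ B₂T}`;
* ★ FILE 5′ `K2LiuAdelicHeightBoxVolume` (p03) — slab decomposition of the height box and the slab Haar measure on `GL_N(L ⊗ ℝ)`.

MAIN THEOREMS.
* `exists_integrable_rpow_neg_adelicHeightGL` — **for every CLOSED subgroup `G ≤ GL_N(𝔸_L)` (`N ≥ 1`) there is `β₀` such that for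
  all `β > β₀` and every Haar measure `ν` on `G`, `g ↦ ‖g‖^{-β}` is `ν`-integrable** (Weil's criterion [WeilBNT1967, VII §3];
  Borel–Jacquet §1.2; Moeglin–Waldspurger I.2.2 — here with NO structure theory of `G`).
* `adelicNormIntegrable` — socket #16b: the case `G = U(diag dV)(𝔸_{L⁺})` (★ `UnitaryGroup.isClosed_adelic`), plus the corner `N = 0`
  (`‖·‖ ≡ 0` is the junk value ★ `adelicHeightGL_eq_zero_of_eq_zero`; the group is trivial, hence compact, and constants are integrable).

No definition, no instance, no named fact; axioms ⊆ {propext, Classical.choice, Quot.sound}.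

## References
* A. Weil, *Basic Number Theory* (1967), Ch. VII §3 [WeilBNT1967].
* A. Borel, H. Jacquet, *Automorphic forms and automorphic representations*, PSPM 33.1 (1979), §1.2 [BorelJacquet1979].
* C. Moeglin, J.-L. Waldspurger, *Spectral decomposition and Eisenstein series* (1995), §I.2.2 [MoeglinWaldspurger1995].
* Y. Liu, *Fourier–Jacobi cycles and arithmetic relative trace formula*, Camb. J. Math. 9 (2021), Lem. B.10 (2) p. 102 [Liu2021].

HONEST LABEL: HC_CM is proved only modulo the 7 printed citations (2 remaining named inputs: hLiu418 =
stmt-HodgeConjecture-24832, h413 = stmt-HodgeConjecture-24833) until rung 0 closes; #16b ∕ #16 ∕ #14a move no counter.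
-/

noncomputable section

set_option autoImplicit false

set_option linter.dupNamespace false

open MeasureTheory Set Filter Topology NumberField NumberField.mixedEmbedding IsDedekindDomain TopologicalSpace
open scoped ENNReal NNReal Pointwise RestrictedProduct Matrix

namespace Summit.HodgeConjecture.HodgeConjecture.Cruxes.HLiu418.K2LiuAdelicNormIntegrable

open Literature.NumberTheory.Automorphic Literature.NumberTheory.GaloisRepresentations
open Literature.NumberTheory.GelbartRogawski1991 Literature.NumberTheory.GelbartRogawski1991.GRConstruction
open Summit.HodgeConjecture.HodgeConjecture.Cruxes.HLiu418.K2LiuSmearingVolumeBound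
open Summit.HodgeConjecture.HodgeConjecture.Cruxes.HLiu418.K2LiuClosedSubgroupHeightBallVolume
open Summit.HodgeConjecture.HodgeConjecture.Cruxes.HLiu418.K2LiuAdelicHeightBoxVolume
open Summit.HodgeConjecture.HodgeConjecture.Cruxes.HLiu418.K2LiuArchHeightBallVolume
open Summit.HodgeConjecture.HodgeConjecture.Cruxes.HLiu418.K2LiuFiniteHeightCosetSeparation
open Summit.HodgeConjecture.HodgeConjecture.Cruxes.HLiu418.K2LiuFiniteHeightCosetCount

variable {N : ℕ} {L : Type} [Field L] [NumberField L]

/-! ## §1 Weil's criterion for closed subgroups of `GL_N(𝔸_L)`, given a polynomial coset cover of the finite height balls -/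

/-- **Polynomial volume growth ⇒ integrability, for a closed subgroup of `GL_N(𝔸_L)`.** Let `N ≥ 1` and suppose the finite height
balls `{y ∈ GL_N(𝔸_{L,f}) : ∏_v H_v(y) ≤ T}` are covered by `≤ C T^D` left cosets of `GL_N(𝒪̂)` (`T ≥ 1`; ★ FILE 4). Then for every
closed subgroup `G ≤ GL_N(𝔸_L)` there is `β₀` such that for all `β > β₀` and every Haar measure `ν` on `G`, `g ↦ ‖g‖^{-β}` is
`ν`-integrable. Assembly: ★ `exists_measure_heightBall_le` (smearing) + ★ `measure_heightBox_le_card_mul_measure_slab` (slabs) +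
★ `archHeightBallVolume` on the slab Haar measure (★ `isHaarMeasure_map_toMixed_restrict`) give `ν{‖g‖ ≤ T} ≤ C' T^{D_∞ + D}` for
`T ≥ 1`; ★ `integrable_rpow_neg_of_measure_le` (layer cake, `‖g‖ ≥ 1/N`) concludes with `β₀ = D_∞ + D`.
[cite: WeilBNT1967, Ch. VII §3] [cite: BorelJacquet1979, §1.2] [cite: MoeglinWaldspurger1995, §I.2.2] -/
theorem exists_integrable_rpow_neg_of_cover [NeZero N]
    (hcover : ∃ (C : ℝ) (D : ℕ), 0 < C ∧ ∀ T : ℝ, 1 ≤ T →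
      ∃ s : Finset (GL (Fin N) (FiniteAdeleRing (𝓞 L) L)), (s.card : ℝ) ≤ C * T ^ D ∧
        ∀ y : GL (Fin N) (FiniteAdeleRing (𝓞 L) L),
          ∏ᶠ v, (GLn.localHeight N L v (GLn.ofFinite N L y) : ℝ) ≤ T → ∃ c ∈ s, c⁻¹ * y ∈ glFiniteIntegralLevel N L)
    (G : Subgroup (GL (Fin N) (AdeleRing (𝓞 L) L))) (hG : IsClosed (G : Set (GL (Fin N) (AdeleRing (𝓞 L) L)))) :
    ∃ β₀ : ℝ, ∀ β : ℝ, β₀ < β →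
      ∀ [MeasurableSpace G] [BorelSpace G] (ν : Measure G) [ν.IsHaarMeasure],
        Integrable (fun g : G => adelicHeightGL N L (g : GL (Fin N) (AdeleRing (𝓞 L) L)) ^ (-β)) ν := by
  classical
  -- topology and Borel structures on `GL_N(𝔸_L)` and `GL_N(L ⊗ ℝ)`
  haveI : T2Space (FiniteAdeleRing (𝓞 L) L) := inferInstanceAs <| T2Space
    (Πʳ w : HeightOneSpectrum (𝓞 L), [w.adicCompletion L, w.adicCompletionIntegers L])
  haveI : T2Space (InfiniteAdeleRing L) :=
    inferInstanceAs <| T2Space ((w : InfinitePlace L) → w.Completion)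
  haveI : T2Space (AdeleRing (𝓞 L) L) :=
    inferInstanceAs <| T2Space (InfiniteAdeleRing L × FiniteAdeleRing (𝓞 L) L)
  haveI : LocallyCompactSpace (GL (Fin N) (AdeleRing (𝓞 L) L)) :=
    AdelicGroupData.locallyCompactSpace_generalLinearGroup_adeleRing (K := L) (ι := Fin N)
  haveI : SecondCountableTopology (GL (Fin N) (AdeleRing (𝓞 L) L)) :=
    secondCountableTopology_generalLinearGroup_adeleRing L (Fin N)
  borelize (GL (Fin N) (AdeleRing (𝓞 L) L))
  borelize (GL (Fin N) (mixedSpace L))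
  -- a Haar measure `μ` on `GL_N(𝔸_L)` and its slab Haar measure on `GL_N(L ⊗ ℝ)`
  obtain ⟨K₀, -⟩ := exists_positiveCompacts_subset (α := GL (Fin N) (AdeleRing (𝓞 L) L)) isOpen_univ univ_nonempty
  set μ : Measure (GL (Fin N) (AdeleRing (𝓞 L) L)) := Measure.haarMeasure K₀ with hμdef
  set μinf : Measure (GL (Fin N) (mixedSpace L)) :=
    Measure.map (GLn.toMixed N L) (μ.restrict {y | GLn.sndHom N L y ∈ glFiniteIntegralLevel N L}) with hμinf
  haveI : μinf.IsHaarMeasure := isHaarMeasure_map_toMixed_restrict (L := L) (N := N) μ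
  obtain ⟨C₂, D₂, hC₂, h2⟩ := archHeightBallVolume L N μinf
  obtain ⟨C₄, D₄, hC₄, h4⟩ := hcover
  refine ⟨((D₂ + D₄ : ℕ) : ℝ), fun β hβ => ?_⟩
  intro _ _ ν _
  obtain ⟨C, B₁, B₂, hC, hB₁, hB₂, h5⟩ := exists_measure_heightBall_le μ G hG ν
  -- the constant
  set C' : ℝ := C.toReal * (C₄ * (1 + B₂) ^ D₄) * (C₂ * (1 + B₁) ^ D₂) with hC'def
  have hC' : 0 ≤ C' := by positivity
  -- volume growth of the height balls of `G`
  have hvol : ∀ T : ℝ, 1 ≤ T →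
      ν {g : G | adelicHeightGL N L (g : GL (Fin N) (AdeleRing (𝓞 L) L)) ≤ T} ≤
        ENNReal.ofReal (C' * T ^ (D₂ + D₄)) := by
    intro T hT
    have hT0 : 0 ≤ T := zero_le_one.trans hT
    -- the finite cover at level `max 1 (B₂ T)`
    obtain ⟨s, hs_card, hs_cov⟩ := h4 (max 1 (B₂ * T)) (le_max_left _ _)
    have hcov : ∀ y : GL (Fin N) (AdeleRing (𝓞 L) L), ∏ᶠ v, (GLn.localHeight N L v y : ℝ) ≤ B₂ * T →
        ∃ c ∈ s, c⁻¹ * GLn.sndHom N L y ∈ glFiniteIntegralLevel N L := by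
      intro y hy
      refine hs_cov (GLn.sndHom N L y) ?_
      have heq : ∏ᶠ v, (GLn.localHeight N L v (GLn.ofFinite N L (GLn.sndHom N L y)) : ℝ) =
          ∏ᶠ v, (GLn.localHeight N L v y : ℝ) :=
        finprod_congr fun v => by rw [← localHeight_eq_localHeight_ofFinite_sndHom]
      rw [heq]
      exact hy.trans (le_max_right _ _)
    -- slabs
    have hslab : μ {y | (GLn.archHeight N L y : ℝ) ≤ B₁ * T ∧ GLn.sndHom N L y ∈ glFiniteIntegralLevel N L} ≤
        ENNReal.ofReal (C₂ * (max 1 (B₁ * T)) ^ D₂) := by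
      rw [measure_slab_eq_map μ (B₁ * T)]
      refine (measure_mono fun x (hx : (GLn.archHeight N L (GLn.ofInfinite N L x) : ℝ) ≤ B₁ * T) => ?_).trans
        (h2 (max 1 (B₁ * T)) (le_max_left _ _))
      exact hx.trans (le_max_right _ _)
    -- chain
    have hcardR : (s.card : ℝ≥0∞) ≤ ENNReal.ofReal (C₄ * (max 1 (B₂ * T)) ^ D₄) := by
      rw [← ENNReal.ofReal_natCast]
      exact ENNReal.ofReal_le_ofReal hs_card
    calc ν {g : G | adelicHeightGL N L (g : GL (Fin N) (AdeleRing (𝓞 L) L)) ≤ T}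
        ≤ C * μ {y | (GLn.archHeight N L y : ℝ) ≤ B₁ * T ∧ ∏ᶠ v, (GLn.localHeight N L v y : ℝ) ≤ B₂ * T} := h5 T
      _ ≤ C * ((s.card : ℝ≥0∞) *
            μ {y | (GLn.archHeight N L y : ℝ) ≤ B₁ * T ∧ GLn.sndHom N L y ∈ glFiniteIntegralLevel N L}) :=
          mul_le_mul' le_rfl (measure_heightBox_le_card_mul_measure_slab μ s (B₁ * T) (B₂ * T) hcov)
      _ ≤ ENNReal.ofReal C.toReal * (ENNReal.ofReal (C₄ * (max 1 (B₂ * T)) ^ D₄) *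
            ENNReal.ofReal (C₂ * (max 1 (B₁ * T)) ^ D₂)) := by
          rw [ENNReal.ofReal_toReal hC]
          exact mul_le_mul' le_rfl (mul_le_mul' hcardR hslab)
      _ = ENNReal.ofReal (C.toReal * (C₄ * (max 1 (B₂ * T)) ^ D₄) * (C₂ * (max 1 (B₁ * T)) ^ D₂)) := by
          have ha : 0 ≤ C₄ * (max 1 (B₂ * T)) ^ D₄ := by positivity
          have hc : 0 ≤ C.toReal := ENNReal.toReal_nonneg
          conv_rhs => rw [ENNReal.ofReal_mul (mul_nonneg hc ha), ENNReal.ofReal_mul hc, mul_assoc]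
      _ ≤ ENNReal.ofReal (C' * T ^ (D₂ + D₄)) := by
          refine ENNReal.ofReal_le_ofReal ?_
          have hM₂ : max 1 (B₂ * T) ≤ (1 + B₂) * T :=
            max_le (by nlinarith) (by nlinarith)
          have hM₁ : max 1 (B₁ * T) ≤ (1 + B₁) * T :=
            max_le (by nlinarith) (by nlinarith)
          have hM₂0 : 0 ≤ max 1 (B₂ * T) := zero_le_one.trans (le_max_left _ _)
          have hM₁0 : 0 ≤ max 1 (B₁ * T) := zero_le_one.trans (le_max_left _ _)
          have hp₂ : (max 1 (B₂ * T)) ^ D₄ ≤ (1 + B₂) ^ D₄ * T ^ D₄ := by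
            rw [← mul_pow]; exact pow_le_pow_left₀ hM₂0 hM₂ D₄
          have hp₁ : (max 1 (B₁ * T)) ^ D₂ ≤ (1 + B₁) ^ D₂ * T ^ D₂ := by
            rw [← mul_pow]; exact pow_le_pow_left₀ hM₁0 hM₁ D₂
          have hCt : 0 ≤ C.toReal := ENNReal.toReal_nonneg
          calc C.toReal * (C₄ * (max 1 (B₂ * T)) ^ D₄) * (C₂ * (max 1 (B₁ * T)) ^ D₂)
              ≤ C.toReal * (C₄ * ((1 + B₂) ^ D₄ * T ^ D₄)) * (C₂ * ((1 + B₁) ^ D₂ * T ^ D₂)) := by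
                gcongr
            _ = C' * T ^ (D₂ + D₄) := by rw [hC'def, pow_add]; ring
  -- the lower bound `‖g‖ ≥ 1/N`
  have hN : (0 : ℝ) < N := by exact_mod_cast Nat.pos_of_ne_zero (NeZero.ne N)
  have hcf : ∀ g : G, (N : ℝ)⁻¹ ≤ adelicHeightGL N L (g : GL (Fin N) (AdeleRing (𝓞 L) L)) := by
    intro g
    have h1 := one_le_mul_archHeight (L := L) (g : GL (Fin N) (AdeleRing (𝓞 L) L))
    have h2 : (GLn.archHeight N L (g : GL (Fin N) (AdeleRing (𝓞 L) L)) : ℝ) ≤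
        adelicHeightGL N L (g : GL (Fin N) (AdeleRing (𝓞 L) L)) :=
      le_mul_of_one_le_right (NNReal.coe_nonneg _) (GLn.one_le_finprod_localHeight _)
    calc (N : ℝ)⁻¹ = (N : ℝ)⁻¹ * 1 := (mul_one _).symm
      _ ≤ (N : ℝ)⁻¹ * (N * (GLn.archHeight N L (g : GL (Fin N) (AdeleRing (𝓞 L) L)) : ℝ)) :=
          mul_le_mul_of_nonneg_left h1 (inv_nonneg.2 hN.le)
      _ = (GLn.archHeight N L (g : GL (Fin N) (AdeleRing (𝓞 L) L)) : ℝ) := by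
          rw [← mul_assoc, inv_mul_cancel₀ hN.ne', one_mul]
      _ ≤ _ := h2
  -- layer cake
  exact integrable_rpow_neg_of_measure_le ν
    (continuous_adelicHeightGL.comp continuous_subtype_val).measurable (inv_pos.2 hN) hcf hC' hvol
    (by exact_mod_cast hβ)

/-! ## §2 The corner `N = 0` -/

/-- For `N = 0` the adelic height is the junk value `0` (★ `adelicHeightGL_eq_zero_of_eq_zero`) and `GL_0` is trivial, so every
subgroup is compact and `g ↦ ‖g‖^{-β}` (a constant) is integrable for every finite-on-compacts measure. [folklore] -/
theorem integrable_rpow_neg_adelicHeightGL_zero (G : Subgroup (GL (Fin 0) (AdeleRing (𝓞 L) L)))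
    [MeasurableSpace G] (ν : Measure G) [IsFiniteMeasureOnCompacts ν] (β : ℝ) :
    Integrable (fun g : G => adelicHeightGL 0 L (g : GL (Fin 0) (AdeleRing (𝓞 L) L)) ^ (-β)) ν := by
  have hconst : (fun g : G => adelicHeightGL 0 L (g : GL (Fin 0) (AdeleRing (𝓞 L) L)) ^ (-β)) =
      fun _ => (0 : ℝ) ^ (-β) := by
    funext g
    rw [adelicHeightGL_eq_zero_of_eq_zero rfl]
  rw [hconst]
  haveI : Subsingleton (GL (Fin 0) (AdeleRing (𝓞 L) L)) := inferInstance
  haveI : Finite G := Finite.of_subsingleton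
  haveI : CompactSpace G := Finite.compactSpace
  exact integrable_const _

/-! ## §3 Socket #16b: `U(V)(𝔸)` -/

/-- **Socket #16b `sig_K2LiuAdelicNormIntegrable` — WEIL'S ADELIC INTEGRABILITY CRITERION FOR `U(V)`** (statement byte-identical to
`Cruxes/HLiu418/Lines/K2_Liu_CurveThetaSigs_U5_DoublingZeta.lean` ED. 5∕6): for non-degenerate hermitian data (`dV i ≠ 0`; in fact unused)
there is `β₀` such that for every `β > β₀` and every Haar measure `ν` on `U(V)(𝔸) = U(diag dV)(𝔸_{L⁺}) ≤ GL_N(𝔸_L)`, `g ↦ ‖g‖^{-β}` is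
`ν`-integrable. `N ≥ 1`: `exists_integrable_rpow_neg_of_cover` for the closed subgroup `U(V)(𝔸)` (★ `UnitaryGroup.isClosed_adelic`) with the
coset cover ★ `K2LiuFiniteHeightCosetCount.exists_finset_cover_finiteHeightBall`; `N = 0`: `integrable_rpow_neg_adelicHeightGL_zero`.
[cite: WeilBNT1967, Ch. VII §3] [cite: BorelJacquet1979, §1.2] [cite: MoeglinWaldspurger1995, §I.2.2] [cite: Liu2021, Lem. B.10 (2) p. 102] -/
theorem adelicNormIntegrable :
    ∀ (L : Type) [Field L] [NumberField L] [IsCMField L] {N : ℕ}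
      (dV : Fin N → L) (_hdV : ∀ i, IsCMField.complexConj L (dV i) = dV i) (_hdV0 : ∀ i, dV i ≠ 0),
      ∃ β₀ : ℝ, ∀ β : ℝ, β₀ < β →
        ∀ [MeasurableSpace (UnitaryGroup.adelic (Fp L) L (IsCMField.complexConj L) N (Matrix.diagonal dV))]
          [BorelSpace (UnitaryGroup.adelic (Fp L) L (IsCMField.complexConj L) N (Matrix.diagonal dV))]
          (ν : Measure (UnitaryGroup.adelic (Fp L) L (IsCMField.complexConj L) N (Matrix.diagonal dV)))
          [ν.IsHaarMeasure],
          Integrable (fun g : UnitaryGroup.adelic (Fp L) L (IsCMField.complexConj L) N (Matrix.diagonal dV) =>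
            adelicHeightGL N L (g : GL (Fin N) (AdeleRing (𝓞 L) L)) ^ (-β)) ν := by
  intro L _ _ _ N dV _ _
  rcases Nat.eq_zero_or_pos N with hN | hN
  · subst hN
    refine ⟨0, fun β _ => ?_⟩
    intro _ _ ν _
    exact integrable_rpow_neg_adelicHeightGL_zero
      (UnitaryGroup.adelic (Fp L) L (IsCMField.complexConj L) 0 (Matrix.diagonal dV)) ν β
  · haveI : NeZero N := ⟨hN.ne'⟩
    exact exists_integrable_rpow_neg_of_cover (L := L) (N := N) (exists_finset_cover_finiteHeightBall L N)
      (UnitaryGroup.adelic (Fp L) L (IsCMField.complexConj L) N (Matrix.diagonal dV))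
      (UnitaryGroup.isClosed_adelic (F := Fp L) (E := L) (c := IsCMField.complexConj L) (N := N)
        (J := Matrix.diagonal dV))

end Summit.HodgeConjecture.HodgeConjecture.Cruxes.HLiu418.K2LiuAdelicNormIntegrable

end
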